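import Mathlib
import HarnessLib
import Summits.ResolutionOfSingularities.ResolutionOfSingularities.Theorems.WildQuotientsWildQuotientResolutionConductorOneAction
import Summits.ResolutionOfSingularities.ResolutionOfSingularities.Theorems.WildQuotientsWildQuotientResolutionTwoBlocksCentreStable
import Literature.AlgebraicGeometry.Resolution.AffineBlowupRegular
import Literature.AlgebraicGeometry.Resolution.AffineBlowupIntegral
import Summits.ResolutionOfSingularities.ResolutionOfSingularities.Theorems.WildQuotientsWildQuotientResolutionZ9PeeledConjCharts

/-!
# S2 brick F3a — the FRAME of the conductor-𝟙 core: the centre `𝔪 = (u₁,…,uₙ)` is `⟨σ⟩`-stable,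
# `V = Bl_𝔪 Spec Aₙ` is an integral proper birational modification, and its vertex charts are stable

(crux stmt-ResolutionOfSingularities-15640 `WildQuotients.WildQuotientResolution`, line `Sketch`; chain w45c post-V5
programme S2 «conductor-𝟙 core», design `L/res-L1-w45c-lead-1/S2-DESIGN.md` §1 «THE FRAME» / §6 brick F3,
res-L1-w45c-plan-1 RULING 2026-08-27T18:23:36Z («033 takes S2 F3 `…ConductorOneFrame` NOW»). [OURS · L1 W4.5c] —
NOT a statement of any manuscript; replaces the role of no printed item; AI-produced, weaker than expert review.
Def-free over the F0 objects `ConductorOne.CoreRing k p n = k[u][Dₙ⁻¹]`, `coreU`, and the F1 law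
`σ (uᵢ)·(1 + uᵢ) = uᵢ`. Prover res-D-pv-033.)

`R := CoreRing k p n`, `σ : R ≃ₐ[k] R` with `hσ : ∀ i, σ (coreU i) * (1 + coreU i) = coreU i`, `G := ⟨σ⟩`,
`𝔪 := Ideal.span (Set.range (coreU k p n))`, `V := affineBlowup 𝔪 = Proj (R[𝔪 t])`, `π := affineBlowup.π 𝔪`.
* `sigma_coreU_eq_mul_unit` / `symm_coreU_eq_mul_unit` / `exists_unit_zpow_coreU` — every `γ ∈ ⟨σ⟩` moves `uᵢ`
  to a UNIT multiple of `uᵢ` (`σ uᵢ = uᵢ (1+uᵢ)⁻¹`, `σ⁻¹ uᵢ = uᵢ (1−uᵢ)⁻¹`; `1 ± uᵢ | Dₙ` are units);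
* `smul_coreMaximal_eq` — `γ • 𝔪 = 𝔪`; `idealSheaf_core_comap` — the `hJ` of `liftAction` for every action `ρ`
  of `⟨σ⟩` on `Spec R` with the affine-quotient law (`AffineQuotient.idealSheaf_comap_specAction`);
* `coreMaximal_ne_bot`, `core_blowup_integral_proper_birational` (`1 ≤ n`);
* `basicOpen_reesT_mul_unit` (generic: `D₊((u·c)t) = D₊(ut)` for a unit `c`), `preimage_coreVertexChart_eq` — the
  vertex charts `V[uᵢ] = D₊(uᵢ t)` are STABLE — and `iSup_coreVertexCharts_eq_top` — they cover `V`.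
-/

-- single-problem summit: the doubled namespace component `ResolutionOfSingularities` is forced
set_option linter.dupNamespace false

noncomputable section

open CategoryTheory AlgebraicGeometry TopologicalSpace MvPolynomial Polynomial
open scoped Pointwise
open Literature.AlgebraicGeometry.Resolution

universe u

namespace Summit.ResolutionOfSingularities.ResolutionOfSingularities.Theorems.WildQuotientResolution

namespace BlowupExit

/-- **A unit factor does not change a Rees chart**: `D₊((u·c) t) = D₊(u t)` for a unit `c` of `R`.
[folklore] -/
theorem basicOpen_reesT_mul_unit {R : Type u} [CommRing R] {I : Ideal R} {a : R} (ha : a ∈ I) (c : Rˣ)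
    (hac : a * c ∈ I) :
    Proj.basicOpen (reesGrading I) (reesT (a * c) hac) = Proj.basicOpen (reesGrading I) (reesT a ha) := by
  have e : reesT (a * c) hac = reesT a ha * algebraMap R (reesAlgebra I) (c : R) := by
    apply Subtype.ext
    simp only [Subalgebra.coe_mul, Subalgebra.coe_algebraMap, coe_reesT, Polynomial.algebraMap_eq,
      Polynomial.monomial_mul_C]
  have hunit : IsUnit (algebraMap R (reesAlgebra I) (c : R)) := (Units.isUnit c).map _
  obtain ⟨v, hv⟩ := hunit.exists_right_inv
  have htop : Proj.basicOpen (reesGrading I) (algebraMap R (reesAlgebra I) (c : R)) = ⊤ := by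
    apply top_le_iff.mp
    calc (⊤ : (Proj (reesGrading I)).Opens) = Proj.basicOpen (reesGrading I) 1 := (Proj.basicOpen_one _).symm
      _ = Proj.basicOpen (reesGrading I) (algebraMap R (reesAlgebra I) (c : R) * v) := by rw [hv]
      _ ≤ _ := by rw [Proj.basicOpen_mul]; exact inf_le_left
  rw [e, Proj.basicOpen_mul, htop, inf_top_eq]

end BlowupExit

namespace ConductorOne

variable (k : Type) [Field k] (p n : ℕ) [Fact p.Prime] [CharP k p]
  (σ : CoreRing k p n ≃ₐ[k] CoreRing k p n)
  (hσ : ∀ i, σ (coreU k p n i) * (1 + coreU k p n i) = coreU k p n i)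

/-! ## `⟨σ⟩` moves each `uᵢ` to a unit multiple of itself -/

omit [CharP k p] in
/-- `1 − uᵢ` is a unit of `Aₙ` (`1 − u ∣ 1 − u^{p−1}`, a factor of `Dₙ`). [OURS · L1 W4.5c] -/
theorem isUnit_one_sub_coreU (i : Fin n) : IsUnit (1 - coreU k p n i) := by
  have hp1 : 1 ≤ p - 1 := by have := (Fact.out : p.Prime).two_le; omega
  have hdvd : (1 - coreU k p n i) ∣ (1 - coreU k p n i ^ (p - 1)) := by
    have h := (one_sub_dvd_one_sub_pow (coreU k p n i) (p - 1))
    exact h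
  exact isUnit_of_dvd_unit hdvd (isUnit_coreFactor k p n i)

include hσ in
/-- `σ uᵢ = uᵢ · (1+uᵢ)⁻¹`. [OURS · L1 W4.5c] -/
theorem sigma_coreU_eq_mul_unit (i : Fin n) :
    σ (coreU k p n i) = coreU k p n i * ↑((isUnit_one_add_coreU k p n i).unit⁻¹) := by
  have h := hσ i
  have hu := (isUnit_one_add_coreU k p n i).unit.mul_inv
  rw [IsUnit.unit_spec] at hu
  calc σ (coreU k p n i) = σ (coreU k p n i) * ((1 + coreU k p n i) *
        ↑((isUnit_one_add_coreU k p n i).unit⁻¹)) := by rw [hu, mul_one]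
    _ = coreU k p n i * ↑((isUnit_one_add_coreU k p n i).unit⁻¹) := by rw [← mul_assoc, h]

omit [CharP k p] in
include hσ in
/-- `σ⁻¹ uᵢ = uᵢ · (1−uᵢ)⁻¹` (apply `σ⁻¹` to the law: `uᵢ (1 + σ⁻¹uᵢ) = σ⁻¹uᵢ`). [OURS · L1 W4.5c] -/
theorem symm_coreU_eq_mul_unit (i : Fin n) :
    σ.symm (coreU k p n i) = coreU k p n i * ↑((isUnit_one_sub_coreU k p n i).unit⁻¹) := by
  have h := congrArg σ.symm (hσ i)
  rw [map_mul, map_add, map_one, σ.symm_apply_apply] at h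
  -- h : σ.symm u * (1 + u) = σ.symm u  ⇒  σ.symm u * (1 - u) = u ... via rearrangement
  have h' : σ.symm (coreU k p n i) * (1 - coreU k p n i) = coreU k p n i := by linear_combination -h
  have hu := (isUnit_one_sub_coreU k p n i).unit.mul_inv
  rw [IsUnit.unit_spec] at hu
  calc σ.symm (coreU k p n i) = σ.symm (coreU k p n i) * ((1 - coreU k p n i) *
        ↑((isUnit_one_sub_coreU k p n i).unit⁻¹)) := by rw [hu, mul_one]
    _ = coreU k p n i * ↑((isUnit_one_sub_coreU k p n i).unit⁻¹) := by rw [← mul_assoc, h']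

include hσ in
/-- Every power of `σ` moves `uᵢ` to a unit multiple of `uᵢ`. [OURS · L1 W4.5c] -/
theorem exists_unit_zpow_coreU (i : Fin n) (z : ℤ) :
    ∃ c : (CoreRing k p n)ˣ, (σ ^ z) (coreU k p n i) = coreU k p n i * c := by
  induction z using Int.induction_on with
  | zero => exact ⟨1, by simp⟩
  | succ j ih =>
    obtain ⟨c, hc⟩ := ih
    refine ⟨(isUnit_one_add_coreU k p n i).unit⁻¹ * (Units.map (σ : CoreRing k p n →* CoreRing k p n) c), ?_⟩
    rw [show (j : ℤ) + 1 = 1 + j from add_comm _ _, zpow_one_add, AlgEquiv.mul_apply, hc, map_mul,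
      sigma_coreU_eq_mul_unit k p n σ hσ i, Units.val_mul, Units.coe_map, mul_assoc]
    rfl
  | pred j ih =>
    obtain ⟨c, hc⟩ := ih
    refine ⟨(isUnit_one_sub_coreU k p n i).unit⁻¹ *
      (Units.map (σ.symm : CoreRing k p n →* CoreRing k p n) c), ?_⟩
    rw [show (-(j : ℤ) - 1) = (-1) + (-j) by ring, zpow_add, zpow_neg_one, AlgEquiv.mul_apply, AlgEquiv.aut_inv,
      hc, map_mul, symm_coreU_eq_mul_unit k p n σ hσ i, Units.val_mul, Units.coe_map, mul_assoc]
    rfl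

include hσ in
/-- For `γ ∈ ⟨σ⟩`: `γ • uᵢ = uᵢ · c` with `c` a unit. [OURS · L1 W4.5c] -/
theorem exists_unit_smul_coreU (γ : Subgroup.zpowers σ) (i : Fin n) :
    ∃ c : (CoreRing k p n)ˣ, γ • coreU k p n i = coreU k p n i * c := by
  obtain ⟨z, hz⟩ := Subgroup.mem_zpowers_iff.mp γ.2
  obtain ⟨c, hc⟩ := exists_unit_zpow_coreU k p n σ hσ i z
  refine ⟨c, ?_⟩
  change (γ : CoreRing k p n ≃ₐ[k] CoreRing k p n) (coreU k p n i) = _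
  rw [← hz]; exact hc

/-! ## The centre is stable -/

include hσ in
/-- `σ • 𝔪 = 𝔪` for `𝔪 = (u₁,…,uₙ)`. [OURS · L1 W4.5c] -/
theorem sigma_smul_coreMaximal_eq :
    σ • Ideal.span (Set.range (coreU k p n)) = Ideal.span (Set.range (coreU k p n)) := by
  have hle : ∀ τ : CoreRing k p n ≃ₐ[k] CoreRing k p n,
      (∀ i, ∃ c : (CoreRing k p n)ˣ, τ (coreU k p n i) = coreU k p n i * c) →
        τ • Ideal.span (Set.range (coreU k p n)) ≤ Ideal.span (Set.range (coreU k p n)) := by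
    intro τ hτ
    rw [Ideal.pointwise_smul_def, Ideal.map_span]
    refine Ideal.span_le.mpr ?_
    rintro _ ⟨_, ⟨i, rfl⟩, rfl⟩
    obtain ⟨c, hc⟩ := hτ i
    change τ (coreU k p n i) ∈ Ideal.span (Set.range (coreU k p n))
    rw [hc]
    exact Ideal.mul_mem_right _ _ (Ideal.subset_span ⟨i, rfl⟩)
  refine le_antisymm (hle σ fun i => ⟨_, sigma_coreU_eq_mul_unit k p n σ hσ i⟩) ?_
  have h2 := hle σ⁻¹ fun i => ⟨(isUnit_one_sub_coreU k p n i).unit⁻¹, by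
    rw [AlgEquiv.aut_inv]; exact symm_coreU_eq_mul_unit k p n σ hσ i⟩
  exact Ideal.subset_pointwise_smul_iff.mpr h2

include hσ in
/-- **`γ • 𝔪 = 𝔪`** for every `γ ∈ ⟨σ⟩`. [OURS · L1 W4.5c] -/
theorem smul_coreMaximal_eq (γ : Subgroup.zpowers σ) :
    γ • Ideal.span (Set.range (coreU k p n)) = Ideal.span (Set.range (coreU k p n)) := by
  obtain ⟨z, hz⟩ := Subgroup.mem_zpowers_iff.mp γ.2
  change (γ : CoreRing k p n ≃ₐ[k] CoreRing k p n) • Ideal.span (Set.range (coreU k p n)) = _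
  rw [← hz]
  exact MulAction.fixedBy_subset_fixedBy_zpow (Ideal (CoreRing k p n)) σ z
    (sigma_smul_coreMaximal_eq k p n σ hσ)

include hσ in
/-- **The ideal sheaf of `𝔪` on `Spec Aₙ` is stable** under every action of `⟨σ⟩` with the affine-quotient law
`ρ γ = Spec (γ⁻¹)` — VERBATIM the hypothesis `hJ` of `IsBlowup.liftAction` for `Bl_𝔪 Spec Aₙ`. [OURS · L1 W4.5c] -/
theorem idealSheaf_core_comap
    (ρ : ↥(Subgroup.zpowers σ) →* Aut (Spec (CommRingCat.of (CoreRing k p n))))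
    (hρ : ∀ γ : ↥(Subgroup.zpowers σ), (ρ γ).hom = Spec.map (CommRingCat.ofHom
      ((MulSemiringAction.toRingEquiv (↥(Subgroup.zpowers σ)) (CoreRing k p n) γ⁻¹ :
        CoreRing k p n ≃+* CoreRing k p n) : CoreRing k p n →+* CoreRing k p n)))
    (γ : ↥(Subgroup.zpowers σ)) :
    (affineBlowup.idealSheaf (Ideal.span (Set.range (coreU k p n)))).comap (ρ γ).hom =
      affineBlowup.idealSheaf (Ideal.span (Set.range (coreU k p n))) :=
  AffineQuotient.idealSheaf_comap_specAction ρ hρ _ (smul_coreMaximal_eq k p n σ hσ) γ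

/-! ## The blow-up -/

omit [CharP k p] in
/-- `𝔪 ≠ 0`. [OURS · L1 W4.5c] -/
theorem coreMaximal_ne_bot (hn : 1 ≤ n) : Ideal.span (Set.range (coreU k p n)) ≠ ⊥ := by
  intro h
  have hmem : coreU k p n ⟨0, hn⟩ ∈ Ideal.span (Set.range (coreU k p n)) := Ideal.subset_span ⟨_, rfl⟩
  rw [h, Ideal.mem_bot] at hmem
  exact coreU_ne_zero k p n _ hmem

omit [CharP k p] in
/-- **`V = Bl_𝔪 Spec Aₙ → Spec Aₙ` is an integral proper birational modification** (`n ≥ 1`).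
[OURS · L1 W4.5c] -/
theorem core_blowup_integral_proper_birational (hn : 1 ≤ n) :
    IsIntegral (affineBlowup (Ideal.span (Set.range (coreU k p n)))) ∧
      IsProper (affineBlowup.π (Ideal.span (Set.range (coreU k p n)))) ∧
      IsBirational (affineBlowup.π (Ideal.span (Set.range (coreU k p n)))) := by
  haveI : IsDomain (CoreRing k p n) := coreRing_isDomain k p n
  exact ⟨affineBlowup.isIntegral (coreMaximal_ne_bot k p n hn), inferInstance,
    affineBlowup.isBirational (coreMaximal_ne_bot k p n hn)⟩

/-! ## The vertex charts are stable and cover -/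

include hσ in
/-- **The vertex chart `V[uᵢ] = D₊(uᵢ t)` is `⟨σ⟩`-stable**: `(L γ)⁻¹ D₊(uᵢ t) = D₊((γ⁻¹•uᵢ) t) = D₊(uᵢ t)`
(unit multiple). [OURS · L1 W4.5c] -/
theorem preimage_coreVertexChart_eq
    (ρ : ↥(Subgroup.zpowers σ) →* Aut (Spec (CommRingCat.of (CoreRing k p n))))
    (hρ : ∀ γ : ↥(Subgroup.zpowers σ), (ρ γ).hom = Spec.map (CommRingCat.ofHom
      ((MulSemiringAction.toRingEquiv (↥(Subgroup.zpowers σ)) (CoreRing k p n) γ⁻¹ :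
        CoreRing k p n ≃+* CoreRing k p n) : CoreRing k p n →+* CoreRing k p n)))
    (hJ : ∀ γ : ↥(Subgroup.zpowers σ),
      (affineBlowup.idealSheaf (Ideal.span (Set.range (coreU k p n)))).comap (ρ γ).hom =
        affineBlowup.idealSheaf (Ideal.span (Set.range (coreU k p n))))
    (γ : ↥(Subgroup.zpowers σ)) (i : Fin n) :
    (((affineBlowup.isBlowup (Ideal.span (Set.range (coreU k p n)))).liftAction ρ hJ) γ).hom ⁻¹ᵁ
        Proj.basicOpen (reesGrading (Ideal.span (Set.range (coreU k p n))))
          (reesT (coreU k p n i) (Ideal.mem_span_range_self (f := coreU k p n) (x := i))) =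
      Proj.basicOpen (reesGrading (Ideal.span (Set.range (coreU k p n))))
        (reesT (coreU k p n i) (Ideal.mem_span_range_self (f := coreU k p n) (x := i))) := by
  obtain ⟨c, hc⟩ := exists_unit_smul_coreU k p n σ hσ γ⁻¹ i
  have hmem : γ⁻¹ • coreU k p n i ∈ Ideal.span (Set.range (coreU k p n)) := by
    rw [hc]; exact Ideal.mul_mem_right _ _ Ideal.mem_span_range_self
  rw [BlowupExit.preimage_basicOpen_reesT_liftAction ρ hρ hJ _ γ hmem]
  have key : ∀ (x : CoreRing k p n) (hx : x ∈ Ideal.span (Set.range (coreU k p n)))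
      (e : x = coreU k p n i * c),
      Proj.basicOpen (reesGrading (Ideal.span (Set.range (coreU k p n)))) (reesT x hx) =
        Proj.basicOpen (reesGrading (Ideal.span (Set.range (coreU k p n))))
          (reesT (coreU k p n i * c) (by rw [← e]; exact hx)) := by
    rintro x hx rfl; rfl
  rw [key _ hmem hc]
  exact BlowupExit.basicOpen_reesT_mul_unit _ c _

omit [Fact p.Prime] [CharP k p] in
/-- **The vertex charts cover `V`**: `⨆ i, D₊(uᵢ t) = ⊤`. [folklore] -/
theorem iSup_coreVertexCharts_eq_top :
    ⨆ i : Fin n, Proj.basicOpen (reesGrading (Ideal.span (Set.range (coreU k p n))))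
        (reesT (coreU k p n i) (Ideal.mem_span_range_self (f := coreU k p n) (x := i))) = ⊤ :=
  affineBlowup.iSup_basicOpen_reesT_generators_eq_top (coreU k p n)

end ConductorOne

end Summit.ResolutionOfSingularities.ResolutionOfSingularities.Theorems.WildQuotientResolution

end
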